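import Summits.NavierStokesRegularity.NavierStokesRegularity.Theses.PumpContinuation
import Summits.NavierStokesRegularity.NavierStokesRegularity.Theses.DssFarFieldSlaving
import Literature.Analysis.FluidPDE.TaoAveragedSobolevProofs

/-!
# Sketch for crux idea `conley-door` (crux `EulerProximatePump`, stmt-NavierStokesRegularity-18302)

First checkable statements of the line "topological persistence near the Euler end":
the amplitude-normalised / accumulation form of the Door, and the interval form.
Nothing here is proved; the point is that the signatures elaborate over existing declarations.
-/

noncomputable section

open MeasureTheory Set Filter
open scoped ENNReal Topology
open Literature.Analysis.FluidPDE Literature.Analysis.FluidPDE.Tao2016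
open Summit.NavierStokesRegularity.NavierStokesRegularity.Theses.PumpContinuation

namespace Summit.NavierStokesRegularity.NavierStokesRegularity.Cruxes.EulerProximatePump.Ideas.ConleyDoor

/-- Local notation for `ℝ³`. -/
local notation "ℝ³" => EuclideanSpace ℝ (Fin 3)

/-- Bounded-temperature blow-up for a trilinear form `T` with ceiling `M` — VERBATIM the standing
disprover's `Cruxes.EulerProximatePump.Disproof.TypeIBlowupFor` (restated here only because the
crux workfile is not a built module on the farm snapshot; a line file imports the Disproof). [folklore] -/
def TypeIBlowupFor (T : L2C → L2C → L2C → ℂ) (M : ℝ) : Prop :=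
  ∃ u₀ : SchwartzMap ℝ³ ℝ³, VectorCalculus.IsDivFree ⇑u₀ ∧ ∃ S : ℝ, 0 < S ∧ ∃ u : ℝ → L2C,
    IsMildSolutionFor T (schwartzL2 u₀) (Ico 0 S) u ∧
    (∀ t ∈ Ico 0 S, eLpNorm (u t) ⊤ volume ≤ ENNReal.ofReal (M / Real.sqrt (S - t))) ∧
    ¬ ∃ S' : ℝ, S < S' ∧ ∃ v : ℝ → L2C,
      IsMildSolutionFor T (schwartzL2 u₀) (Ico 0 S') v ∧ ∀ t ∈ Ico 0 S, v t = u t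

/-- The Euler form perturbed in the averaged direction `B̃_𝒜` with amplitude `η`:
`B + η B̃_𝒜` (again a symmetric cancelling averaged form; by amplitude scaling `u ↦ θu`,
`T_θ = (1-θ)B̃ + θB` with `θ = 1/(1+η)` is `θ · (B + η B̃)`). [folklore] -/
def pertForm (𝒜 : AveragingDatum) (η : ℝ) : L2C → L2C → L2C → ℂ :=
  fun a b c => eulerForm a b c + ((η : ℝ) : ℂ) * 𝒜.form a b c

/-- **First lemma (interface of the line with the crux as typed).** If bounded-temperature
Type-I blow-up parameters of `B + η B̃_𝒜` ACCUMULATE at `η = 0⁺` (a sequence suffices — this is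
exactly what real-analytic curve selection / index continuation delivers), then the Door holds:
amplitude normalisation `v := u/θ`, `θ := 1/(1+η) ∈ (1-δ, 1)`, ceiling `2M`. Provable now
(bilinearity of `eulerForm`/`form` in the state, linearity of `heat`, `pairing`, `schwartzL2`). -/
theorem door_of_accumulating
    (h : ∃ 𝒜 : AveragingDatum, 𝒜.IsSymmetric ∧ 𝒜.HasCancellation ∧ ∃ M : ℝ, ∀ η₀ : ℝ, 0 < η₀ →
      ∃ η : ℝ, 0 < η ∧ η < η₀ ∧ TypeIBlowupFor (pertForm 𝒜 η) M) :
    EulerProximatePump := by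
  sorry

/-- **Tier (ii) of the card (structural stability).** Robust Type-I blow-up on a whole
punctured interval of amplitudes in ONE averaged direction gives the Door (trivial from
`door_of_accumulating`; recorded because index continuation yields the interval form while
index-zero unfolding yields only a sequence). -/
theorem door_of_interval
    (h : ∃ 𝒜 : AveragingDatum, 𝒜.IsSymmetric ∧ 𝒜.HasCancellation ∧ ∃ M η₀ : ℝ, 0 < η₀ ∧
      ∀ η : ℝ, 0 < η → η < η₀ → TypeIBlowupFor (pertForm 𝒜 η) M) :
    EulerProximatePump := by
  obtain ⟨𝒜, hs, hc, M, η₀, hη₀, hall⟩ := h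
  refine door_of_accumulating ⟨𝒜, hs, hc, M, fun η₁ hη₁ => ?_⟩
  refine ⟨min η₀ η₁ / 2, by positivity, ?_, hall _ (by positivity) ?_⟩
  · calc min η₀ η₁ / 2 < min η₀ η₁ := by linarith [lt_min hη₀ hη₁]
      _ ≤ η₁ := min_le_right _ _
  · calc min η₀ η₁ / 2 < min η₀ η₁ := by linarith [lt_min hη₀ hη₁]
      _ ≤ η₀ := min_le_left _ _

/-- **The structural-stability stub, abstract shape (tier ii).** What index continuation must
deliver on the NS side, stated as the persistence of Schwartz-data Type-I blow-up of the TRUE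
Navier–Stokes form under every small perturbation inside one averaged direction: this is the
hypothesis of `door_of_interval` with the quantifiers exposed. (A `Prop` definition, not a claim.) -/
def RobustNSTypeI (𝒜 : AveragingDatum) : Prop :=
  ∃ M η₀ : ℝ, 0 < η₀ ∧ ∀ η : ℝ, 0 < η → η < η₀ → TypeIBlowupFor (pertForm 𝒜 η) M

/-- Tier (ii) restated: a robust NS Type-I blow-up in some symmetric cancelling direction is a Door. -/
theorem door_of_robustNSTypeI {𝒜 : AveragingDatum} (hs : 𝒜.IsSymmetric) (hc : 𝒜.HasCancellation)
    (h : RobustNSTypeI 𝒜) : EulerProximatePump :=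
  door_of_interval ⟨𝒜, hs, hc, h⟩


/-! ## Tier (i): the Door is downstream of the SHARED profile + Type-I truncation items

`BlowupTypeIDssProfile` (stmt-0155, shared by Blowup / DssFarFieldSlaving / …) and
`DssTruncationBridgeTypeI` (stmt-14478) give a classical maximal Type-I blow-up from a rapidly
decaying datum; the bookkeeping `ClassicalTypeIToMild` (the Euler-datum half of the PROVED
`PerpetualPump.EulerTypeIGlue`, stmt-1838, read forwards) turns it into `NSTypeI`, and the standing
disprover's `door_of_nsTypeI` (re-proved below as `door_of_nsTypeI'`) gives the Door. -/

open Summit.NavierStokesRegularity.NavierStokesRegularity.Theses.DssFarFieldSlaving in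
/-- Bookkeeping stub (provable now, M-sized): a classical maximal smooth Leray–Hopf solution from a
rapidly decaying datum with the Type-I rate at its lifespan is, after `ν ↦ 1`, an `H¹⁰_df`-mild
Type-I blow-up of the Euler form from a Schwartz datum with no mild extension. -/
def ClassicalTypeIToMild : Prop :=
  ∀ ν : ℝ, 0 < ν → ∀ T : ℝ, 0 < T →
    ∀ (u : ℝ → ℝ³ → ℝ³) (p : ℝ → ℝ³ → ℝ),
      IsMaximalSmoothSolution ν 0 u p T → IsLerayHopfOn T ν 0 (u 0) u → HasRapidSpatialDecay (u 0) →
      IsTypeIBlowup u T → ∃ M : ℝ, TypeIBlowupFor eulerForm M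

/-- `Door ⇐ NSTypeI` (the disprover's `door_of_nsTypeI`, re-proved here over the local
`TypeIBlowupFor`): the Euler datum collapses the segment. -/
theorem door_of_nsTypeI' (h : ∃ M : ℝ, TypeIBlowupFor eulerForm M) : EulerProximatePump := by
  obtain ⟨M, hM⟩ := h
  refine ⟨AveragingDatum.euler, AveragingDatum.euler_isSymmetric,
    AveragingDatum.euler_hasCancellation, M, fun δ hδ => ?_⟩
  refine ⟨max (1 - δ / 2) 0, lt_of_lt_of_le (by linarith) (le_max_left _ _),
    max_lt (by linarith) one_pos, le_max_right _ _, ?_⟩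
  have hform : (fun a b c => (((1 - max (1 - δ / 2) 0 : ℝ) : ℝ) : ℂ) * AveragingDatum.euler.form a b c +
      (((max (1 - δ / 2) 0 : ℝ) : ℝ) : ℂ) * eulerForm a b c) = eulerForm := by
    funext a b c
    rw [AveragingDatum.euler_form]
    push_cast
    ring
  rw [hform]
  exact hM

open Summit.NavierStokesRegularity.NavierStokesRegularity.Theses.DssFarFieldSlaving in
/-- **Tier (i) wiring (sorry-free logic):** shared profile item + shared Type-I truncation bridge +
bookkeeping ⇒ the Door. -/
theorem door_of_profile_bridge (hP : BlowupTypeIDssProfile) (hB : DssTruncationBridgeTypeI)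
    (hbook : ClassicalTypeIToMild) : EulerProximatePump := by
  obtain ⟨ν, hν, T, hT, u, p, hmax, hLH, hdec, hI⟩ := hB hP
  exact door_of_nsTypeI' (hbook ν hν T hT u p hmax hLH hdec hI)

end Summit.NavierStokesRegularity.NavierStokesRegularity.Cruxes.EulerProximatePump.Ideas.ConleyDoor

end
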